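import Summits.HodgeConjecture.HodgeConjecture.Theorems.R90S6RegularTreeBallCount     -- ★ this seat (HF1, FILE A0): `ncard_ball_inter_type_zero_eq ∕ _one_eq`, `ncard_sphere_inter_type_eq`, `ncard_sphere_eq_of_regular_tree`, `exists_adj_dist_le_of_dist_eq_succ`
import Summits.HodgeConjecture.HodgeConjecture.Theorems.R90S6CompressionFrameTestU2  -- ★ this seat (HF1, FILE A2): `mapGL_latt_frame_le_of_le`, `v_lt_one_of_mapGL_latt_frame_le`, `false_of_v_lt_one_of_frame`; brings FILE A1 (normal frames `exists_latt_frame_chain`, `dist_root_eq_of_latt_frame_chain`, `latticeTreeIso_apply_eq_self_iff_mapGL_le`, `formCongr_antidiagonal_two_apply_zero_zero`), ★ A1-H FILE 1 (`typeFun_ne_of_adj_two`), ★ `TreeDisplacement.exists_height_parent`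
import HarnessLib

/-!
# R90 · S6 — CARD HF1 (row E1.3.5.2.6, H side), FILE A3: THE FIXED SET AND THE FIRST SHELLS ON `X₂` OF THE UNRAMIFIED-`E¹` COMPRESSION `δ₁`
# (`Theorems/R90S6TreeFixDataUnramifiedU2.lean`)

Cell `hodgecm-mathlib`, crux H413 (`stmt-HodgeConjecture-24833`), route of record `HCCMUnconditional`; programme R90-TF, section S6 (base `R90-C14`), seat
R90-C14-p03 (g3); card HF1 «Fix AND FIRST SHELLS ON `X₂` FOR THE UNRAMIFIED-`E¹` COMPRESSIONS» (dealer R90-C14-plan (g2), R90 bus 2026-09-05T02:03:01Z ∕ 02:15:20Z;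
consumer: typ1 (g3)'s (E1) sheet `S6_E1352_elliptic_identity_targets.v1.1` — the H-side DATA binders `F₀ⱼ, N₀ⱼ, N₁ⱼ`).  Helper lane `--supports stmt-HodgeConjecture-24833
--as helper`; THEOREMS ONLY (no definition, no instance, no notation, no named fact, no `sorry`).

SETTING (★ A1-H ∕ ★ H2 ∕ ★ H2-NUMBERS letters).  `K : Type` with `Valued K ℤᵐ⁰` and `ValuativeRel K` compatible, the cell's unramified datum `hd : UnramifiedLocalConjDatum σ ϖ`,
`J₂ = (StdForm.antidiagonal 2).over K`, `U₂ = unitaryGroupOfForm σ J₂`, `X₂ = latticeTree σ ϖ J₂` (★ `isTree_latticeTree`), root `x₀` with `x₀.1 = latt 1 = 𝒪²`, `U₂`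
acting by ★ `latticeTreeIso`.  THE ELEMENT: `δ ∈ U₂` with matrix `!![e(a+c), −e(a−c); −e(a−c), e(a+c)]` (`2e = 1`, `v 2 = 1`, `a, c ∈ K¹` norm-one, `Valued.v (a − c) = exp(−n)`)
— the `{0,2}`-compression `δ₁` of Flicker's `t_1(a,b,c)` (the (E1) sheet's `hδ₁` literal VERBATIM).

* §1 **`latticeTreeIso_compression_apply_eq_self_iff_dist_le`: `δ·v = v ↔ d(x₀, v) ≤ n`** — THE FIXED SET OF `δ₁` IS THE BALL OF RADIUS `n = v(a − c)` ABOUT THE ROOT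
  (`n = 0`, residually separated eigenvalues: `Fix = {x₀}`).  Proof: FILE A1 frames `v` as the end of a framed geodesic of level `N = d(x₀, v)`; FILE A2's frame tests give
  `δ·v.1 ≤ v.1` when `N ≤ n` and the residual impossibility when `N > n`.  No transitivity, Cartan cover or compactness is used.
* §2 THE DATA on the tree with finite neighbour sets (`hloc`) in which EVERY vertex has valency `q + 1` (`hreg`; the `(q_v+1)`-regular tree of `U(1,1)_w` — the interior of the
  ball matters, not only the moved vertices), type function `ty` (`ty v = 0 ↔ v` self-dual, ★ H2-NUMBERS letters):
  **`F₀ = #{x self-dual : δx = x} = 1 + (q+1) Σ_{j<⌊n∕2⌋} q^{2j+1}`** (even spheres of the ball), the `ϖ`-modular twin **`#{x not self-dual : δx = x} =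
  (q+1) Σ_{j<⌊(n+1)∕2⌋} q^{2j}`** (odd spheres; by the type swap of FILE B this is `F₀` of the θ-shifted class `δ_ϖ`), and the FIRST SHELLS: `{x : d(x, δx) = 2}` is the sphere
  of radius `n + 1` (★ `TreeDisplacement.exists_height_parent`: `d(x, δx) = 2·d(x, Fix δ)`), of the type of parity `n + 1`: **`N₀ = [n odd]·(q+1)qⁿ`, `N₁ = [n even]·(q+1)qⁿ`**.
  Checks: `n = 0`: `(F₀, N₀, N₁) = (1, 0, q+1)` (dealer's residually-separated values); `n = 1`: `(1, (q+1)q, 0)`; `n = 2`: `(1 + (q+1)q, 0, (q+1)q²)`.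
HONEST LABEL: lattice∕tree bookkeeping over ★ carriers; proves no printed global statement, discharges no citation; count-neutral helper until (E1) consumes it.
HC_CM is proved only modulo the 7 printed citations (2 remaining named inputs: hLiu418 = stmt-HodgeConjecture-24832, h413 = stmt-HodgeConjecture-24833) until rung 0 closes; REL ≠ ★ ≠ BUILT.

## References
* [Rogawski1990] J. D. Rogawski, *Automorphic Representations of Unitary Groups in Three Variables*, Ann. of Math. Stud. 123 (1990): §4.9 pp. 54–56 (elliptic terms of the
  fundamental lemma for `(U(3), U(2) × U(1))`; classes in a stable class), §3.5–3.6.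
* [LabesseLanglands1979] J.-P. Labesse, R. P. Langlands, *L-indistinguishability for SL(2)*, Canad. J. Math. 31 (1979): §§2–3 (rank one: fixed balls of elliptic elements).
* [Serre1980Trees] J.-P. Serre, *Trees* (1980): I.2.3 Ex. 2, I.6.4 Prop. 24, II.1.1 (`d(x, γx) = 2 d(x, Fix γ)`; spheres of a regular tree; the tree of a rank-one group).
* [Kottwitz1986BaseChangeUnits] R. E. Kottwitz, *Base change for unit elements of Hecke algebras*, Compositio Math. 60 (1986): §1 pp. 240–242, §3.
-/

set_option autoImplicit false
-- the mandated namespace repeats the single-problem summit's segment (`HodgeConjecture.HodgeConjecture`)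
set_option linter.dupNamespace false

noncomputable section

open Set Function
open scoped ValuativeRel Matrix MatrixGroups
open SimpleGraph Matrix ValuativeRel
open Literature.NumberTheory.Automorphic
open Literature.NumberTheory.Automorphic.HermitianLatticeTree
open Literature.Combinatorics.SimpleGraph

namespace Summit.HodgeConjecture.HodgeConjecture.R90.S6

section Two

variable {K : Type} [Field K] [Valued K (WithZero (Multiplicative ℤ))] [ValuativeRel K]
  [(Valued.v : Valuation K (WithZero (Multiplicative ℤ))).Compatible] {σ : K →+* K} {ϖ : K}

/-! ## §1 THE FIXED SET OF THE COMPRESSION IS THE BALL OF RADIUS `n = v(a − c)` ABOUT THE ROOT -/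

/-- **HF1.1 — `Fix_{X₂}(δ₁) = Ball(x₀, n)`**: for the `{0,2}`-compression `δ ∈ U₂` of Flicker's `t_1(a,b,c)` (matrix `!![e(a+c), −e(a−c); −e(a−c), e(a+c)]`, `2e = 1`, residue
characteristic `≠ 2`, `a, c ∈ K¹` with `v(a − c) = exp(−n)`) and every vertex `v` of the tree `X₂` of `U(1,1)_w`: **`δ·v = v ↔ d(x₀, v) ≤ n`**, `x₀ = 𝒪²` the root.  In particular
for residually separated eigenvalues (`n = 0`) the fixed set is the root alone.  Proof: §2 frames `v` as the end `A_N` of a framed geodesic (`N = d(x₀, v)`, §1); §3's frame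
tests give `δ·v.1 ≤ v.1` when `N ≤ n`, and for `N > n` they force the residual impossibility `false_of_v_lt_one_of_frame`.
[cite: Rogawski1990, §4.9 pp. 54–55] [cite: LabesseLanglands1979, §§2–3] [cite: Serre1980Trees, I.6.4, II.1.1] -/
theorem latticeTreeIso_compression_apply_eq_self_iff_dist_le (hd : HermitianLattice.UnramifiedLocalConjDatum σ ϖ) (h2 : Valued.v (2 : K) = 1)
    {e a c : K} (h2e : 2 * e = 1) (ha : σ a * a = 1) (hc : σ c * c = 1) {n : ℕ} (hn : Valued.v (a - c) = WithZero.exp (-(n : ℤ)))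
    (δ : unitaryGroupOfForm σ ((StdForm.antidiagonal 2).over K))
    (hδ : ((δ : GL (Fin 2) K) : Matrix (Fin 2) (Fin 2) K) = !![e * (a + c), -(e * (a - c)); -(e * (a - c)), e * (a + c)])
    (x₀ : {M : Submodule 𝒪[K] (Fin 2 → K) // IsSpecialLattice σ ϖ ((StdForm.antidiagonal 2).over K) M})
    (hx₀ : x₀.1 = latt (1 : Matrix (Fin 2) (Fin 2) K))
    (v : {M : Submodule 𝒪[K] (Fin 2 → K) // IsSpecialLattice σ ϖ ((StdForm.antidiagonal 2).over K) M}) :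
    latticeTreeIso σ ϖ ((StdForm.antidiagonal 2).over K) δ v = v ↔ (latticeTree σ ϖ ((StdForm.antidiagonal 2).over K)).dist x₀ v ≤ n := by
  have hϖ := isUniformizingElement_of_v_eq hd.vϖ
  obtain ⟨P, hP, N, hG, hv⟩ := exists_latt_frame_chain hd v
  rw [dist_root_eq_of_latt_frame_chain hd x₀ hx₀ P hP N hG v le_rfl hv, latticeTreeIso_apply_eq_self_iff_mapGL_le hd δ v, hv]
  constructor
  · intro hle
    by_contra hNn
    rw [not_le] at hNn
    have hr := v_lt_one_of_mapGL_latt_frame_le hd h2 h2e hc hn (δ : GL (Fin 2) K) hδ P hNn hle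
    -- `|G₀₀| ≤ |ϖ|^N < 1` since `N ≥ 1`
    have hG' : Valued.v (σ ((P : Matrix (Fin 2) (Fin 2) K) 0 0) * (P : Matrix (Fin 2) (Fin 2) K) 1 0 +
        σ ((P : Matrix (Fin 2) (Fin 2) K) 1 0) * (P : Matrix (Fin 2) (Fin 2) K) 0 0) < 1 := by
      rw [← formCongr_antidiagonal_two_apply_zero_zero P, v_lt_one_iff_valuation_lt_one]
      exact lt_of_le_of_lt hG (Left.pow_lt_one_of_lt hϖ.valuation_lt_one (by omega))
    exact false_of_v_lt_one_of_frame hd h2 P hP hG' hr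
  · intro hNn
    exact mapGL_latt_frame_le_of_le hd h2 h2e ha hc hn (δ : GL (Fin 2) K) hδ P hP (by omega) (by omega)

/-! ## §2 THE DATA `(F₀, N₀, N₁)` of `δ₁` on the `(q+1)`-regular tree (and the `ϖ`-modular fixed count, the `F₀` of the θ-shifted class) -/

/-- **HF1 — `F₀(δ₁) = #{x self-dual : δ₁x = x} = 1 + (q+1) Σ_{j<⌊n∕2⌋} q^{2j+1}`** (the self-dual vertices of `Ball(x₀, n)` = the even spheres; `n = 0, 1`: `F₀ = 1`; `n = 2, 3`:
`1 + (q+1)q`), on the tree with finite neighbour sets in which every vertex has valency `q + 1` (`q = q_v`).  Set-builder = ★ H2-NUMBERS `…_closed_two` :189 `F₀` VERBATIM.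
[cite: Rogawski1990, §4.9 pp. 54–55] [cite: LabesseLanglands1979, §§2–3] [cite: Serre1980Trees, I.2.3 Ex. 2, II.1.1] -/
theorem ncard_selfDual_fixed_compression_eq (hd : HermitianLattice.UnramifiedLocalConjDatum σ ϖ) (h2 : Valued.v (2 : K) = 1)
    {e a c : K} (h2e : 2 * e = 1) (ha : σ a * a = 1) (hc : σ c * c = 1) {n : ℕ} (hn : Valued.v (a - c) = WithZero.exp (-(n : ℤ)))
    (δ : unitaryGroupOfForm σ ((StdForm.antidiagonal 2).over K))
    (hδ : ((δ : GL (Fin 2) K) : Matrix (Fin 2) (Fin 2) K) = !![e * (a + c), -(e * (a - c)); -(e * (a - c)), e * (a + c)])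
    (x₀ : {M : Submodule 𝒪[K] (Fin 2 → K) // IsSpecialLattice σ ϖ ((StdForm.antidiagonal 2).over K) M})
    (hx₀ : x₀.1 = latt (1 : Matrix (Fin 2) (Fin 2) K))
    (hloc : ∀ v, ((latticeTree σ ϖ ((StdForm.antidiagonal 2).over K)).neighborSet v).Finite) (q : ℕ)
    (hreg : ∀ v, ((latticeTree σ ϖ ((StdForm.antidiagonal 2).over K)).neighborSet v).ncard = q + 1) :
    {x : {M : Submodule 𝒪[K] (Fin 2 → K) // IsSpecialLattice σ ϖ ((StdForm.antidiagonal 2).over K) M} |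
        IsSelfDualLattice σ ((StdForm.antidiagonal 2).over K) x.1 ∧ latticeTreeIso σ ϖ ((StdForm.antidiagonal 2).over K) δ x = x}.ncard =
      1 + (q + 1) * ∑ j ∈ Finset.range (n / 2), q ^ (2 * j + 1) := by
  classical
  have hσv := valuation_map_eq_of_datum hd
  have hϖ := isUniformizingElement_of_v_eq hd.vϖ
  have hH := isUnimodular₂_antidiagonal_two (K := K)
  haveI := isDiscreteValuationRing_integer_of_compatible hd.vϖ
  have hT := isTree_latticeTree σ hσv hϖ hH
  let ty : {M : Submodule 𝒪[K] (Fin 2 → K) // IsSpecialLattice σ ϖ ((StdForm.antidiagonal 2).over K) M} → Fin 2 :=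
    fun v => if IsSelfDualLattice σ ((StdForm.antidiagonal 2).over K) v.1 then 0 else 1
  have hty0 : ∀ v, ty v = 0 ↔ IsSelfDualLattice σ ((StdForm.antidiagonal 2).over K) v.1 := fun v => by
    by_cases h : IsSelfDualLattice σ ((StdForm.antidiagonal 2).over K) v.1 <;> simp [ty, h]
  have htc := typeFun_ne_of_adj_two hd ty hty0
  have h0 : ty x₀ = 0 := (hty0 x₀).2 (by rw [hx₀]; exact isSelfDualLattice_latt_one σ hH)
  have hset : {x : {M : Submodule 𝒪[K] (Fin 2 → K) // IsSpecialLattice σ ϖ ((StdForm.antidiagonal 2).over K) M} |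
        IsSelfDualLattice σ ((StdForm.antidiagonal 2).over K) x.1 ∧ latticeTreeIso σ ϖ ((StdForm.antidiagonal 2).over K) δ x = x} =
      {x | (latticeTree σ ϖ ((StdForm.antidiagonal 2).over K)).dist x₀ x ≤ n ∧ ty x = 0} := by
    ext x
    simp only [Set.mem_setOf_eq, latticeTreeIso_compression_apply_eq_self_iff_dist_le hd h2 h2e ha hc hn δ hδ x₀ hx₀, hty0]
    exact and_comm
  rw [hset]
  exact ncard_ball_inter_type_zero_eq hT x₀ ty htc h0 hloc q hreg n

/-- **HF1 — the `ϖ`-modular fixed count `#{x not self-dual : δ₁x = x} = (q+1) Σ_{j<⌊(n+1)∕2⌋} q^{2j}`** (the `ϖ`-modular vertices of `Ball(x₀, n)` = the odd spheres;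
`n = 0`: `0`; `n = 1, 2`: `q+1`) — by the type swap (FILE B) this is `F₀` of the θ-shifted class `δ_ϖ = diag(ϖ,1) δ₁ diag(ϖ,1)⁻¹`.
[cite: Rogawski1990, §4.9 pp. 54–55] [cite: LabesseLanglands1979, §§2–3] [cite: Serre1980Trees, I.2.3 Ex. 2, II.1.1] -/
theorem ncard_not_selfDual_fixed_compression_eq (hd : HermitianLattice.UnramifiedLocalConjDatum σ ϖ) (h2 : Valued.v (2 : K) = 1)
    {e a c : K} (h2e : 2 * e = 1) (ha : σ a * a = 1) (hc : σ c * c = 1) {n : ℕ} (hn : Valued.v (a - c) = WithZero.exp (-(n : ℤ)))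
    (δ : unitaryGroupOfForm σ ((StdForm.antidiagonal 2).over K))
    (hδ : ((δ : GL (Fin 2) K) : Matrix (Fin 2) (Fin 2) K) = !![e * (a + c), -(e * (a - c)); -(e * (a - c)), e * (a + c)])
    (x₀ : {M : Submodule 𝒪[K] (Fin 2 → K) // IsSpecialLattice σ ϖ ((StdForm.antidiagonal 2).over K) M})
    (hx₀ : x₀.1 = latt (1 : Matrix (Fin 2) (Fin 2) K))
    (hloc : ∀ v, ((latticeTree σ ϖ ((StdForm.antidiagonal 2).over K)).neighborSet v).Finite) (q : ℕ)
    (hreg : ∀ v, ((latticeTree σ ϖ ((StdForm.antidiagonal 2).over K)).neighborSet v).ncard = q + 1) :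
    {x : {M : Submodule 𝒪[K] (Fin 2 → K) // IsSpecialLattice σ ϖ ((StdForm.antidiagonal 2).over K) M} |
        ¬ IsSelfDualLattice σ ((StdForm.antidiagonal 2).over K) x.1 ∧ latticeTreeIso σ ϖ ((StdForm.antidiagonal 2).over K) δ x = x}.ncard =
      (q + 1) * ∑ j ∈ Finset.range ((n + 1) / 2), q ^ (2 * j) := by
  classical
  have hσv := valuation_map_eq_of_datum hd
  have hϖ := isUniformizingElement_of_v_eq hd.vϖ
  have hH := isUnimodular₂_antidiagonal_two (K := K)
  haveI := isDiscreteValuationRing_integer_of_compatible hd.vϖ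
  have hT := isTree_latticeTree σ hσv hϖ hH
  let ty : {M : Submodule 𝒪[K] (Fin 2 → K) // IsSpecialLattice σ ϖ ((StdForm.antidiagonal 2).over K) M} → Fin 2 :=
    fun v => if IsSelfDualLattice σ ((StdForm.antidiagonal 2).over K) v.1 then 0 else 1
  have hty0 : ∀ v, ty v = 0 ↔ IsSelfDualLattice σ ((StdForm.antidiagonal 2).over K) v.1 := fun v => by
    by_cases h : IsSelfDualLattice σ ((StdForm.antidiagonal 2).over K) v.1 <;> simp [ty, h]
  have hty1 : ∀ v, ty v = 1 ↔ ¬ IsSelfDualLattice σ ((StdForm.antidiagonal 2).over K) v.1 := fun v => by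
    by_cases h : IsSelfDualLattice σ ((StdForm.antidiagonal 2).over K) v.1 <;> simp [ty, h]
  have htc := typeFun_ne_of_adj_two hd ty hty0
  have h0 : ty x₀ = 0 := (hty0 x₀).2 (by rw [hx₀]; exact isSelfDualLattice_latt_one σ hH)
  have hset : {x : {M : Submodule 𝒪[K] (Fin 2 → K) // IsSpecialLattice σ ϖ ((StdForm.antidiagonal 2).over K) M} |
        ¬ IsSelfDualLattice σ ((StdForm.antidiagonal 2).over K) x.1 ∧ latticeTreeIso σ ϖ ((StdForm.antidiagonal 2).over K) δ x = x} =
      {x | (latticeTree σ ϖ ((StdForm.antidiagonal 2).over K)).dist x₀ x ≤ n ∧ ty x = 1} := by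
    ext x
    simp only [Set.mem_setOf_eq, latticeTreeIso_compression_apply_eq_self_iff_dist_le hd h2 h2e ha hc hn δ hδ x₀ hx₀, hty1]
    exact and_comm
  rw [hset]
  exact ncard_ball_inter_type_one_eq hT x₀ ty htc h0 hloc q hreg n

/-- **HF1 — THE FIRST SHELLS OF `δ₁`, typed**: `#{x : d(x, δ₁x) = 2 ∧ ty x = i} = (q+1)·qⁿ` if `i` has the parity of `n + 1` (`i = 1 ↔ n` even) and `0` otherwise — the vertices
displaced by `2` are those at distance `1` from `Fix δ₁ = Ball(x₀, n)` (★ `TreeDisplacement.exists_height_parent`: `d(x, δx) = 2·d(x, Fix)`), i.e. the sphere of radius `n + 1`,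
whose type is the parity of `n + 1`.  Set-builder = ★ H2-NUMBERS `N_i` letters (`ty`, `hty0`) VERBATIM. [cite: Serre1980Trees, I.6.4 Prop. 24, II.1.1] [cite: Rogawski1990, §4.9 pp. 54–55] -/
theorem ncard_displaced_two_inter_type_compression_eq (hd : HermitianLattice.UnramifiedLocalConjDatum σ ϖ) (h2 : Valued.v (2 : K) = 1)
    {e a c : K} (h2e : 2 * e = 1) (ha : σ a * a = 1) (hc : σ c * c = 1) {n : ℕ} (hn : Valued.v (a - c) = WithZero.exp (-(n : ℤ)))
    (δ : unitaryGroupOfForm σ ((StdForm.antidiagonal 2).over K))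
    (hδ : ((δ : GL (Fin 2) K) : Matrix (Fin 2) (Fin 2) K) = !![e * (a + c), -(e * (a - c)); -(e * (a - c)), e * (a + c)])
    (x₀ : {M : Submodule 𝒪[K] (Fin 2 → K) // IsSpecialLattice σ ϖ ((StdForm.antidiagonal 2).over K) M})
    (hx₀ : x₀.1 = latt (1 : Matrix (Fin 2) (Fin 2) K))
    (hloc : ∀ v, ((latticeTree σ ϖ ((StdForm.antidiagonal 2).over K)).neighborSet v).Finite) (q : ℕ)
    (hreg : ∀ v, ((latticeTree σ ϖ ((StdForm.antidiagonal 2).over K)).neighborSet v).ncard = q + 1)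
    (ty : {M : Submodule 𝒪[K] (Fin 2 → K) // IsSpecialLattice σ ϖ ((StdForm.antidiagonal 2).over K) M} → Fin 2)
    (hty0 : ∀ v, ty v = 0 ↔ IsSelfDualLattice σ ((StdForm.antidiagonal 2).over K) v.1) (i : Fin 2) :
    {x : {M : Submodule 𝒪[K] (Fin 2 → K) // IsSpecialLattice σ ϖ ((StdForm.antidiagonal 2).over K) M} |
        (latticeTree σ ϖ ((StdForm.antidiagonal 2).over K)).dist x (latticeTreeIso σ ϖ ((StdForm.antidiagonal 2).over K) δ x) = 2 ∧ ty x = i}.ncard =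
      if (Even n ↔ i = 1) then (q + 1) * q ^ n else 0 := by
  classical
  have hσv := valuation_map_eq_of_datum hd
  have hϖ := isUniformizingElement_of_v_eq hd.vϖ
  have hH := isUnimodular₂_antidiagonal_two (K := K)
  haveI := isDiscreteValuationRing_integer_of_compatible hd.vϖ
  have hT := isTree_latticeTree σ hσv hϖ hH
  have htc := typeFun_ne_of_adj_two hd ty hty0
  have h0 : ty x₀ = 0 := (hty0 x₀).2 (by rw [hx₀]; exact isSelfDualLattice_latt_one σ hH)
  have hfix := latticeTreeIso_compression_apply_eq_self_iff_dist_le hd h2 h2e ha hc hn δ hδ x₀ hx₀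
  have hx₀fix : latticeTreeIso σ ϖ ((StdForm.antidiagonal 2).over K) δ x₀ = x₀ := (hfix x₀).2 (by simp)
  -- the displacement is twice the distance to the fixed ball
  obtain ⟨h, p, hdist, h00, -, -, -, hdisp⟩ := TreeDisplacement.exists_height_parent hT (latticeTreeIso σ ϖ ((StdForm.antidiagonal 2).over K) δ) hx₀fix
  have hset : {x : {M : Submodule 𝒪[K] (Fin 2 → K) // IsSpecialLattice σ ϖ ((StdForm.antidiagonal 2).over K) M} |
        (latticeTree σ ϖ ((StdForm.antidiagonal 2).over K)).dist x (latticeTreeIso σ ϖ ((StdForm.antidiagonal 2).over K) δ x) = 2 ∧ ty x = i} =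
      {x | (latticeTree σ ϖ ((StdForm.antidiagonal 2).over K)).dist x₀ x = n + 1 ∧ ty x = i} := by
    ext x
    simp only [Set.mem_setOf_eq, hdisp]
    refine and_congr_left fun _ => ?_
    constructor
    · intro h2x
      have h1 : h x = 1 := by omega
      -- a fixed vertex at distance `1`, hence `d(x₀, x) ≤ n + 1`; and `x` is not fixed, hence `d(x₀, x) > n`
      obtain ⟨y, hy, hxy⟩ := (hdist x).1
      have hyn : (latticeTree σ ϖ ((StdForm.antidiagonal 2).over K)).dist x₀ y ≤ n := (hfix y).1 hy
      have hle : (latticeTree σ ϖ ((StdForm.antidiagonal 2).over K)).dist x₀ x ≤ n + 1 := by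
        have htri := hT.1.dist_triangle (u := x₀) (v := y) (w := x)
        rw [SimpleGraph.dist_comm (u := y), hxy, h1] at htri
        omega
      have hnot : ¬ (latticeTree σ ϖ ((StdForm.antidiagonal 2).over K)).dist x₀ x ≤ n := fun hxn => by
        have := (h00 x).2 ((hfix x).2 hxn); omega
      omega
    · intro hx
      have hnot : h x ≠ 0 := fun hx0 => by
        have := (hfix x).1 ((h00 x).1 hx0); omega
      obtain ⟨y, hyx, hy⟩ := exists_adj_dist_le_of_dist_eq_succ hT.1 x₀ hx
      have hyfix : latticeTreeIso σ ϖ ((StdForm.antidiagonal 2).over K) δ y = y := (hfix y).2 hy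
      have h1 : h x ≤ 1 := by
        have := (hdist x).2 y hyfix
        rw [SimpleGraph.dist_eq_one_iff_adj.2 hyx.symm] at this
        exact this
      omega
  rw [hset, ncard_sphere_inter_type_eq hT x₀ ty htc h0 (n + 1) i]
  have fin2 : ∀ x : Fin 2, x = 0 ∨ x = 1 := by decide
  have hs := ncard_sphere_eq_of_regular_tree hT x₀ hloc q hreg (by omega : 1 ≤ n + 1)
  rw [Nat.add_sub_cancel] at hs
  rcases fin2 i with rfl | rfl <;> by_cases hn' : Even n
  · have h1 : ¬ (Even (n + 1) ↔ (0 : Fin 2) = 0) := fun h => (Nat.even_add_one.1 (h.2 rfl)) hn'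
    have h2 : ¬ (Even n ↔ (0 : Fin 2) = 1) := fun h => absurd (h.1 hn') (by decide)
    rw [if_neg h1, if_neg h2]
  · have h1 : (Even (n + 1) ↔ (0 : Fin 2) = 0) := iff_of_true (Nat.even_add_one.2 hn') rfl
    have h2 : (Even n ↔ (0 : Fin 2) = 1) := ⟨fun h => absurd h hn', fun h => absurd h (by decide)⟩
    rw [if_pos h1, if_pos h2, hs]
  · have h1 : (Even (n + 1) ↔ (1 : Fin 2) = 0) := ⟨fun h => absurd hn' (Nat.even_add_one.1 h), fun h => absurd h (by decide)⟩
    have h2 : (Even n ↔ (1 : Fin 2) = 1) := iff_of_true hn' rfl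
    rw [if_pos h1, if_pos h2, hs]
  · have h1 : ¬ (Even (n + 1) ↔ (1 : Fin 2) = 0) := fun h => absurd (h.1 (Nat.even_add_one.2 hn')) (by decide)
    have h2 : ¬ (Even n ↔ (1 : Fin 2) = 1) := fun h => hn' (h.2 rfl)
    rw [if_neg h1, if_neg h2]

/-- **HF1 — `N₀(δ₁) = #{x : d(x, δ₁x) = 2 ∧ ty x = 0} = [n odd]·(q+1)qⁿ`** (self-dual first shell; `n = 0`: `N₀ = 0`). The (E1′) binder `hN₀ⱼ` for `j = 1`.
[cite: Serre1980Trees, I.6.4 Prop. 24, II.1.1] [cite: Rogawski1990, §4.9 pp. 54–55] -/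
theorem ncard_displaced_two_type_zero_compression_eq (hd : HermitianLattice.UnramifiedLocalConjDatum σ ϖ) (h2 : Valued.v (2 : K) = 1)
    {e a c : K} (h2e : 2 * e = 1) (ha : σ a * a = 1) (hc : σ c * c = 1) {n : ℕ} (hn : Valued.v (a - c) = WithZero.exp (-(n : ℤ)))
    (δ : unitaryGroupOfForm σ ((StdForm.antidiagonal 2).over K))
    (hδ : ((δ : GL (Fin 2) K) : Matrix (Fin 2) (Fin 2) K) = !![e * (a + c), -(e * (a - c)); -(e * (a - c)), e * (a + c)])
    (x₀ : {M : Submodule 𝒪[K] (Fin 2 → K) // IsSpecialLattice σ ϖ ((StdForm.antidiagonal 2).over K) M})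
    (hx₀ : x₀.1 = latt (1 : Matrix (Fin 2) (Fin 2) K))
    (hloc : ∀ v, ((latticeTree σ ϖ ((StdForm.antidiagonal 2).over K)).neighborSet v).Finite) (q : ℕ)
    (hreg : ∀ v, ((latticeTree σ ϖ ((StdForm.antidiagonal 2).over K)).neighborSet v).ncard = q + 1)
    (ty : {M : Submodule 𝒪[K] (Fin 2 → K) // IsSpecialLattice σ ϖ ((StdForm.antidiagonal 2).over K) M} → Fin 2)
    (hty0 : ∀ v, ty v = 0 ↔ IsSelfDualLattice σ ((StdForm.antidiagonal 2).over K) v.1) :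
    {x : {M : Submodule 𝒪[K] (Fin 2 → K) // IsSpecialLattice σ ϖ ((StdForm.antidiagonal 2).over K) M} |
        (latticeTree σ ϖ ((StdForm.antidiagonal 2).over K)).dist x (latticeTreeIso σ ϖ ((StdForm.antidiagonal 2).over K) δ x) = 2 ∧ ty x = 0}.ncard =
      if Even n then 0 else (q + 1) * q ^ n := by
  rw [ncard_displaced_two_inter_type_compression_eq hd h2 h2e ha hc hn δ hδ x₀ hx₀ hloc q hreg ty hty0 0]
  by_cases hn' : Even n
  · rw [if_neg (fun h => absurd (h.1 hn') (by decide)), if_pos hn']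
  · rw [if_pos ⟨fun h => absurd h hn', fun h => absurd h (by decide)⟩, if_neg hn']

/-- **HF1 — `N₁(δ₁) = #{x : d(x, δ₁x) = 2 ∧ ty x = 1} = [n even]·(q+1)qⁿ`** (`ϖ`-modular first shell; `n = 0`: `N₁ = q + 1`, the `q+1` neighbours of the root, all moved).
The (E1′) binder `hN₁ⱼ` for `j = 1`. [cite: Serre1980Trees, I.6.4 Prop. 24, II.1.1] [cite: Rogawski1990, §4.9 pp. 54–55] -/
theorem ncard_displaced_two_type_one_compression_eq (hd : HermitianLattice.UnramifiedLocalConjDatum σ ϖ) (h2 : Valued.v (2 : K) = 1)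
    {e a c : K} (h2e : 2 * e = 1) (ha : σ a * a = 1) (hc : σ c * c = 1) {n : ℕ} (hn : Valued.v (a - c) = WithZero.exp (-(n : ℤ)))
    (δ : unitaryGroupOfForm σ ((StdForm.antidiagonal 2).over K))
    (hδ : ((δ : GL (Fin 2) K) : Matrix (Fin 2) (Fin 2) K) = !![e * (a + c), -(e * (a - c)); -(e * (a - c)), e * (a + c)])
    (x₀ : {M : Submodule 𝒪[K] (Fin 2 → K) // IsSpecialLattice σ ϖ ((StdForm.antidiagonal 2).over K) M})
    (hx₀ : x₀.1 = latt (1 : Matrix (Fin 2) (Fin 2) K))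
    (hloc : ∀ v, ((latticeTree σ ϖ ((StdForm.antidiagonal 2).over K)).neighborSet v).Finite) (q : ℕ)
    (hreg : ∀ v, ((latticeTree σ ϖ ((StdForm.antidiagonal 2).over K)).neighborSet v).ncard = q + 1)
    (ty : {M : Submodule 𝒪[K] (Fin 2 → K) // IsSpecialLattice σ ϖ ((StdForm.antidiagonal 2).over K) M} → Fin 2)
    (hty0 : ∀ v, ty v = 0 ↔ IsSelfDualLattice σ ((StdForm.antidiagonal 2).over K) v.1) :
    {x : {M : Submodule 𝒪[K] (Fin 2 → K) // IsSpecialLattice σ ϖ ((StdForm.antidiagonal 2).over K) M} |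
        (latticeTree σ ϖ ((StdForm.antidiagonal 2).over K)).dist x (latticeTreeIso σ ϖ ((StdForm.antidiagonal 2).over K) δ x) = 2 ∧ ty x = 1}.ncard =
      if Even n then (q + 1) * q ^ n else 0 := by
  rw [ncard_displaced_two_inter_type_compression_eq hd h2 h2e ha hc hn δ hδ x₀ hx₀ hloc q hreg ty hty0 1]
  by_cases hn' : Even n
  · rw [if_pos (iff_of_true hn' rfl), if_pos hn']
  · rw [if_neg (fun h => hn' (h.2 rfl)), if_neg hn']


end Two

end Summit.HodgeConjecture.HodgeConjecture.R90.S6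

end
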